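import Literature.NumberTheory.GaloisRepresentations.GaloisCohomology
import Literature.NumberTheory.GaloisRepresentations.TameInertia
import Mathlib.FieldTheory.Finite.Basic
import HarnessLib

/-!
# Preliminaries for the tame chain in Tate's theorem: `μ_p`, the residue characteristic, kernels
# (cell `b2b-bsdres`, team n1011, row T-EPC = Tate's local Euler–Poincaré characteristic; seat p04 GEN 8; stage D3b-i)

HONEST FRAMING (cell `b2b-bsdres`, run/shared/lean/b2b/bsd-rank1-residual/, verbatim in every
file): the goal of the cell is to DELETE the COMBINATION-SHAPED residual classes of the
Birch–Swinnerton-Dyer formula for ALL analytic-rank `≤ 1` elliptic curves over `ℚ` — "full BSD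
formula for every rank `≤ 1` curve in class `C`" assembled STRICTLY from published theorems — so
that the rank-`≤ 1` remainder becomes exactly the CONSTRUCTION-SHAPED classes, which are TYPED
(missing-input `Prop`s), NOT attempted. This is not "finishing BSD". Team n1011 (N10 / N11, the
additive block X4 ∧ `p = 3`): research route; no claim beyond the stated classes; nothing is
booked; no mark / label is changed by this file. Theorems only (no definition, no named fact, no
`sorry`).  (Placement: Summits/GaloisImage with the T-EPC cone.)

## What

Three small inputs of the `ℓ = p` case of Tate's local Euler–Poincaré formula (Milne *ADT* I
Thm. 2.8: "`L/K` finite Galois such that `Gal(K̄/L)` acts trivially on `M` and on `μ_p`"):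

* `EPCTame.smul_pow_sub_one_eq_self` — a group acting on a cyclic group of exponent `p` acts
  through `(ℤ/p)ˣ`: `σ^{p-1}` acts trivially (Fermat); hence `EPCTame.mu_eq_self_of_pow`: **an
  element of `Γ_K` some `p`-power of which fixes `μ_p(K̄)` fixes `μ_p(K̄)`**;
* `EPCTame.valuation_ringChar_lt_one` — `|p|_K < 1` for the residue characteristic `p`;
* `EPCTame.isOpen_ker` — the kernel of a finite discrete `Γ`-module is open.

References: J. S. Milne, *Arithmetic Duality Theorems* (2006), I §2 [MilneADT2006];
J.-P. Serre, *Local Fields* (1979), IV §2 [SerreLocalFields1979].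
-/

noncomputable section

open Function Field
open scoped ValuativeRel
open Literature.NumberTheory.GaloisRepresentations
open Literature.NumberTheory.GaloisRepresentations.DiscreteGaloisModule

universe u

namespace Summit.BirchSwinnertonDyer.Rank1Residual.GaloisImage

namespace EPCTame

/-! ### Automorphisms of a cyclic group of exponent `p` -/

section Cyclic

variable {G C : Type*} [Group G] [CommGroup C] [IsCyclic C] [MulDistribMulAction G C]

omit [IsCyclic C] in
/-- `σ^k` acts on a cyclic group as `g ↦ g^{m^k}` when `σ` acts as `g ↦ g^m`. [folklore] -/
theorem pow_smul_eq_zpow {σ : G} {m : ℤ} (hm : ∀ g : C, σ • g = g ^ m) (k : ℕ) (g : C) :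
    σ ^ k • g = g ^ (m ^ k) := by
  induction k generalizing g with
  | zero => rw [pow_zero, one_smul, pow_zero, zpow_one]
  | succ k ih => rw [pow_succ, mul_smul, hm, smul_zpow', ih, ← zpow_mul, ← pow_succ]

/-- **A group acting on a cyclic group of prime exponent `p` acts through `(ℤ/p)ˣ`: `σ^{p-1}`
acts trivially** (an endomorphism of a cyclic group is `g ↦ g^m`, Mathlib `MonoidHom.map_cyclic`;
Fermat's little theorem). [folklore] -/
theorem smul_pow_sub_one_eq_self {p : ℕ} (hp : p.Prime) (hC : ∀ c : C, c ^ p = 1) (σ : G) (c : C) :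
    σ ^ (p - 1) • c = c := by
  obtain ⟨m, hm⟩ := MonoidHom.map_cyclic (MulDistribMulAction.toMonoidHom C σ)
  have hm' : ∀ g : C, σ • g = g ^ m := fun g => hm g
  rw [pow_smul_eq_zpow hm']
  by_cases hdvd : (p : ℤ) ∣ m
  · -- `σ` acts as `g ↦ (g^p)^{m/p} = 1`: the group is trivial
    obtain ⟨q, rfl⟩ := hdvd
    have htriv : ∀ g : C, g = 1 := fun g => by
      apply MulAction.injective σ
      change σ • g = σ • (1 : C)
      rw [smul_one, hm', zpow_mul, zpow_natCast, hC, one_zpow]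
    rw [htriv c, one_zpow]
  · have hcop : IsCoprime m p :=
      ((Prime.coprime_iff_not_dvd (Nat.prime_iff_prime_int.mp hp)).2 hdvd).symm
    have h1 : m ^ (p - 1) ≡ 1 [ZMOD p] := Int.ModEq.pow_card_sub_one_eq_one hp hcop
    have hord : (orderOf c : ℤ) ∣ p := by exact_mod_cast orderOf_dvd_of_pow_eq_one (hC c)
    have h2 : m ^ (p - 1) ≡ 1 [ZMOD orderOf c] := Int.ModEq.of_dvd hord h1
    rw [← zpow_one c, ← zpow_mul, one_mul, zpow_one]
    conv_rhs => rw [← zpow_one c]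
    exact zpow_eq_zpow_iff_modEq.2 h2

/-- If `σ^{p^k}` acts trivially on a cyclic group of exponent `p` then so does `σ`
(`gcd(p^k, p - 1) = 1`). [folklore] -/
theorem smul_eq_self_of_pow {p : ℕ} (hp : p.Prime) (hC : ∀ c : C, c ^ p = 1) (σ : G) {k : ℕ}
    (hk : ∀ c : C, σ ^ p ^ k • c = c) (c : C) : σ • c = c := by
  -- the subgroup of elements acting trivially
  let S : Subgroup G := ⨅ c : C, MulAction.stabilizer G c
  have hS : ∀ x : G, x ∈ S ↔ ∀ c : C, x • c = c := fun x => by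
    simp only [S, Subgroup.mem_iInf, MulAction.mem_stabilizer_iff]
  have h1 : σ ^ p ^ k ∈ S := (hS _).2 hk
  have h2 : σ ^ (p - 1) ∈ S := (hS _).2 (smul_pow_sub_one_eq_self hp hC σ)
  have hcopr : Nat.Coprime (p ^ k) (p - 1) := by
    refine Nat.Coprime.pow_left k ((Nat.Prime.coprime_iff_not_dvd hp).2 ?_)
    exact Nat.not_dvd_of_pos_of_lt (Nat.sub_pos_of_lt hp.one_lt) (Nat.sub_lt hp.pos one_pos)
  obtain ⟨u, v, huv⟩ := (Nat.isCoprime_iff_coprime.mpr hcopr)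
  have hσ : σ = (σ ^ p ^ k) ^ u * (σ ^ (p - 1)) ^ v := by
    rw [← zpow_natCast, ← zpow_natCast σ (p - 1), ← zpow_mul, ← zpow_mul, ← zpow_add,
      mul_comm ((p ^ k : ℕ) : ℤ) u, mul_comm ((p - 1 : ℕ) : ℤ) v, huv, zpow_one]
  have hmem : σ ∈ S := by
    rw [hσ]
    exact S.mul_mem (S.zpow_mem h1 u) (S.zpow_mem h2 v)
  exact (hS σ).1 hmem c

end Cyclic

/-! ### `μ_p(K̄)` -/

section Mu

variable (K : Type u) [Field K] (p : ℕ) [hp : Fact p.Prime]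

omit hp in
/-- `mu K p σ ζ = ζ` iff `σ` fixes the underlying root of unity. [folklore] -/
theorem mu_apply_eq_self_iff_smul (σ : absoluteGaloisGroup K) (ζ : MuCarrier K p) :
    mu K p σ ζ = ζ ↔
      σ • ((MuCarrier.toAdditive ζ).toMul : rootsOfUnity p (AlgebraicClosure K)) =
        (MuCarrier.toAdditive ζ).toMul := by
  rw [← MuCarrier.toAdditive.injective.eq_iff, mu_apply_apply]
  exact Additive.ofMul.injective.eq_iff

/-- **An element of `Γ_K` a `p`-power of which fixes `μ_p(K̄)` fixes `μ_p(K̄)`** (`Aut μ_p` has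
order `p - 1`). [cite: MilneADT2006, I §2 proof of Thm 2.8] -/
theorem mu_eq_self_of_pow (σ : absoluteGaloisGroup K) {k : ℕ}
    (h : ∀ ζ : MuCarrier K p, mu K p (σ ^ p ^ k) ζ = ζ) (ζ : MuCarrier K p) : mu K p σ ζ = ζ := by
  rw [mu_apply_eq_self_iff_smul]
  have hC : ∀ c : rootsOfUnity p (AlgebraicClosure K), c ^ p = 1 := fun c =>
    Subtype.ext (by rw [SubmonoidClass.coe_pow, OneMemClass.coe_one]; exact (mem_rootsOfUnity _ _).1 c.2)
  refine smul_eq_self_of_pow hp.out hC σ (k := k) (fun c => ?_) _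
  have := (mu_apply_eq_self_iff_smul K p (σ ^ p ^ k) (MuCarrier.ofRootsOfUnity c)).1 (h _)
  exact this

end Mu

/-! ### The residue characteristic and kernels -/

section LocalField

variable (K : Type u) [Field K] [ValuativeRel K] [TopologicalSpace K] [IsNonarchimedeanLocalField K]

/-- **`|p|_K < 1` for the residue characteristic `p = char 𝓀[K]`** (`p ↦ 0` in `𝓀[K]`, so
`p ∈ 𝓂[K]`). [cite: SerreLocalFields1979, Ch. I §1] -/
theorem valuation_ringChar_lt_one :
    ValuativeRel.valuation K ((ringChar 𝓀[K] : ℕ) : K) < 1 := by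
  have h0 : ((ringChar 𝓀[K] : ℕ) : 𝓀[K]) = 0 := ringChar.Nat.cast_ringChar
  have hmem : ((ringChar 𝓀[K] : ℕ) : 𝒪[K]) ∈ 𝓂[K] := by
    rw [← IsLocalRing.residue_eq_zero_iff, map_natCast]
    exact h0
  have hnu : ¬ IsUnit ((ringChar 𝓀[K] : ℕ) : 𝒪[K]) := (IsLocalRing.mem_maximalIdeal _).mp hmem
  have := Valuation.Integer.not_isUnit_iff_valuation_lt_one.mp hnu
  rwa [SubringClass.coe_natCast] at this

end LocalField

section Kernel

variable {Γ : Type u} [Group Γ] [TopologicalSpace Γ]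
variable {M : Type u} [AddCommGroup M] [TopologicalSpace M] [DiscreteTopology M] [Finite M]

/-- **The kernel of a finite discrete module is open**: `{g | ∀ m, ρ g m = m}` is a finite
intersection of open stabilisers. [folklore] -/
theorem isOpen_setOf_forall_apply_eq (ρ : ContinuousRep Γ ℤ M) :
    IsOpen {g : Γ | ∀ m : M, ρ g m = m} := by
  have : {g : Γ | ∀ m : M, ρ g m = m} = ⋂ m : M, (fun g => ρ g m) ⁻¹' {m} := by
    ext g; simp
  rw [this]
  exact isOpen_iInter_of_finite fun m => (isOpen_discrete _).preimage (ρ.continuous_apply_left m)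

omit [DiscreteTopology M] [Finite M] in
/-- Membership in the kernel of the underlying representation. [folklore] -/
theorem mem_ker_toRepresentation_iff (ρ : ContinuousRep Γ ℤ M) (g : Γ) :
    g ∈ ρ.toRepresentation.ker ↔ ∀ m : M, ρ g m = m := by
  rw [MonoidHom.mem_ker, LinearMap.ext_iff]
  rfl

/-- The kernel `ker ρ ≤ Γ` of a finite discrete module is an open (normal) subgroup. [folklore] -/
theorem isOpen_ker (ρ : ContinuousRep Γ ℤ M) : IsOpen (ρ.toRepresentation.ker : Set Γ) := by
  have : (ρ.toRepresentation.ker : Set Γ) = {g : Γ | ∀ m : M, ρ g m = m} := by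
    ext g; exact mem_ker_toRepresentation_iff ρ g
  rw [this]
  exact isOpen_setOf_forall_apply_eq ρ

end Kernel

end EPCTame

end Summit.BirchSwinnertonDyer.Rank1Residual.GaloisImage

end
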